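/-
Copyright (c) 2026 the pub-hodgecm-mathlib formalisation cell (harness21).  Prover seat hodgecm-mathlib-K2E1-p15 (g3), Track B ∕ K2-LIT, h413 = `stmt-HodgeConjecture-24833`,
R90-TF section S8 «ContSpec-n½», #4′ road, the MODEL-FAMILY brick (deal S8-R45 2026-09-04T22:25:38Z; census `R90/S8/CENSUS-ModelFamily.K2E1-p15-g3.md`): the block-model maps
`U b : L² →ₗ[ℂ] A b × Λ b` of the R1 defs of record (★ p862464) BUILT from per-block Plancherel isometries, and the model-side letters `hOD ∕ hLnU ∕ hLnP ∕ hχb` DISCHARGED generically.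
-/
import Summits.HodgeConjecture.HodgeConjecture.Theorems.R90S8ResHResiduesOrthogonalWavePacketsU2   -- ★ p862491 (this seat): (O) `isOrtho_iSup_resHAtom_iSup_resHLine_of_letters'`; brings ★ DEFS p862464 `resHBlock` ∕ `resHAtom` ∕ `resHLine` + read-backs
import Summits.HodgeConjecture.HodgeConjecture.Theorems.K2E1ChiSectionBoundedOfUnitaryU2          -- ★ (K2E3-p12): `exists_bound_of_isChiSection_of_isUnitary` (continuous sections of a unitary datum are bounded)
import Literature.NumberTheory.Automorphic.AsaiAtOneRankOne                                      -- ★ `HeckeCharacter.isUnitary_of_map_posRealIdele` (ray-trivial ⇒ unitary; `C_K¹` compact)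
import Mathlib.Analysis.InnerProductSpace.ProdL2                                            -- Mathlib `WithLp 2 (A × Λ)` (the `L²` product model), `WithLp.linearEquiv`
import Mathlib.Analysis.InnerProductSpace.Projection.Basic                                  -- Mathlib `Submodule.orthogonalProjectionOnto`, `starProjection`, `sub_starProjection_mem_orthogonal`
import HarnessLib

/-!
# S8 #4′ road — `R90S8ResHBlockModelFamilyU2`: THE BLOCK-MODEL MAPS `U = ι ∘ U_iso ∘ P_{Sc}` OF THE R1 DEFS, AND THE MODEL-SIDE LETTERS `hOD ∕ hLnU ∕ hLnP ∕ hχb` DISCHARGED (ED. 1: the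
# generic packaging; the analytic per-block packages enter ED. 2 by name)

Track B ∕ K2-LIT, crux h413 = `stmt-HodgeConjecture-24833`, route of record `HCCMUnconditional`; cell `hodgecm-mathlib`, R90-TF programme, section S8 «ContSpec-n½», socket #4′
`sock_S8_resH_spannedByCharLines` (B ED. 4 :256).  THEOREMS ONLY (no `def`, no `instance`, no `notation`, no named-fact hypothesis, no `sorry`; default heartbeats); lane
`--supports stmt-HodgeConjecture-24833 --as helper` (count-neutral).  CLOSES NO SOCKET.  It serves H7 (K2E1-p14 (g3) `Theorems/R90S8ResHSpannedByCharLinesQuasiSplit.lean`): of the binders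
H7 ED. 1 keeps visible, this file DISCHARGES, for the two explicit block-model maps below, the R1 interface letters `hLnU` ((N-iface), ★ p862453's spelling, in fact for ALL `y`), `hOD` (off-dual
blocks have no pure atoms), the reduction of `hLnP` to «`Sc ≤ V_P`», and `hχb` (bounded sections, from unitarity BY NAME); the ANALYTIC inputs — the per-block Plancherel isometry `U_iso`
(self-dual: G9 LEVEL package; off-dual: ★ `exists_repr_and_linearIsometry_chiSection_offDual_letterFree_cm_two`) and the Hecke∕symbol data `T hT𝓐 hTP hTB s hs hU hline` — stay what they are.

THE MATHEMATICS ([ReedSimonI1980, Thm. II.3 (projection theorem), Thm. I.7]; [MoeglinWaldspurger1995, II.2.4, VI.2]).  Let `Sc = resHBlock K′ ω χ ≤ L²` (closed, hence complete, with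
orthogonal projection `P_{Sc}`).  SELF-DUAL MODEL: from a linear isometry `U_iso : Sc →ₗᵢ (A × Λ)_{ℓ²}` (atoms × line) put `U := ι ∘ U_iso ∘ P_{Sc} : L² →ₗ A × Λ` (`ι` the set-theoretic
identification `WithLp 2 (A × Λ) ≃ₗ A × Λ`).  OFF-DUAL MODEL: from `U_iso : Sc →ₗᵢ Λ` put `U := (0, U_iso ∘ P_{Sc})`.  Both FACTOR THROUGH `P_{Sc}` (`U y = U (P_{Sc} y)`) and are INJECTIVE ON
`Sc`; the off-dual one has first coordinate `0`.  Consequences for the R1 data `At = Sc ⊓ ker (snd ∘ U)`, `Ln = Sc ⊓ Atᗮ`: (N-iface) for EVERY `y ∈ L²` with `(U y).2 = 0` and every `v ∈ Ln`,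
`⟪v, y⟫ = 0` (apply ★ `inner_eq_zero_of_mem_resHLine` to `y = P_{Sc} y + (y − P_{Sc} y)`); off-dual: `(U v).2 = 0 ∧ v ∈ Sc ⇒ U v = 0 ⇒ v = 0`, i.e. `At = ⊥` (`hOD`) and `Ln = Sc`; `hLnP` is
`Ln ≤ Sc ≤ V_P`; `hχb` is ★ `exists_bound_of_isChiSection_of_isUnitary`.
* §1 ABSTRACT (any `U : L² →ₗ[ℂ] A × Λ`): `inner_eq_zero_of_mem_resHLine_of_factor` ((N-iface) for all `y` from the factorisation), `hLnU_of_factor` (★ p862453's `hLnU` bytes, any guard set),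
  `resHAtom_eq_bot_of_injOn_of_fst_eq_zero` (`hOD`), `resHLine_eq_resHBlock_of_resHAtom_eq_bot`, `hLnP_of_resHBlock_le` (`hLnP` from `Sc ≤ V_P`).
* §2 THE SELF-DUAL-TYPE MODEL `U = ι ∘ U_iso ∘ P_{Sc}`: `completeSpace_resHBlock` (instance supply), `sdModelMap_apply_of_mem`, `sdModelMap_factor`, `sdModelMap_injOn`, and the letters
  **`inner_eq_zero_of_mem_resHLine_sdModelMap`**, **`hLnU_sdModelMap`**.
* §3 THE OFF-DUAL MODEL `U = (0, U_iso ∘ P_{Sc})`: `odModelMap_factor`, `odModelMap_injOn`, `odModelMap_fst`, **`resHAtom_odModelMap_eq_bot`** (`hOD`), `resHLine_odModelMap_eq_resHBlock`,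
  **`hLnU_odModelMap`**.
* §4 `hχb_of_isUnitary` — the bounded-section letter of (O)∕(E_blk)∕R6 at any `(K′, ω)` from `χ` unitary, BY NAME; `isUnitary_coe_index` ∕ `hχb_index` — for a C7 index `b`
  (ray-trivial) unitarity is ★ `HeckeCharacter.isUnitary_of_map_posRealIdele b.2.1`, so `hu` AND `hχb` are DISCHARGED outright.
* §5 **`isOrtho_iSup_resHAtom_iSup_resHLine_of_hOD`** — letter (O) (★ p862491 `…_of_letters'`) with `hu`, `hχb` DISCHARGED: visible = ★ R6's structural Haar ∕ fundamental-domain data + the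
  model letter `hOD` only.
* §6 **`exists_blockModelFamily`** — THE FAMILY PACKAGING over the C7 index at `(K′, ω)`: from per-block model data `model b : (Sc_b →ₗᵢ (A b × Λ b)_{ℓ²}) ⊕ (Sc_b →ₗᵢ Λ b)` (left = a
  self-dual Plancherel isometry [G9 letter], right = an off-dual one [★ `exists_repr_and_linearIsometry_chiSection_offDual_letterFree_cm_two`]) a family `U b : L² →ₗ[ℂ] A b × Λ b` with:
  factorisation through `P_{Sc_b}` (`hUfac`, ⇒ `hLnU` by §1), injectivity on `Sc_b` (`hUinj`), the generator read-backs `U b v = ofLp (U_iso v)` ∕ `U b v = (0, U_iso v)` on `Sc_b`, and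
  `resHAtom (U b) = ⊥` for every right-modelled block — hence `hOD` whenever the off-dual blocks are right-modelled (`hOD_of_blockModelFamily`).  H7 keeps `U` as a binder with exactly these
  property names; the final letter-free edition `obtain`s it here.
HONEST LABEL: HC_CM is proved only modulo the 7 printed citations (2 remaining named inputs: hLiu418 = `stmt-HodgeConjecture-24832`, h413 = `stmt-HodgeConjecture-24833`) until
rung 0 closes; REL ≠ ★ ≠ BUILT; this file asserts no named fact and closes no socket; count-neutral.

## References
* [ReedSimonI1980] M. Reed, B. Simon, *Methods of Modern Mathematical Physics I: Functional Analysis* (1980), Thm. II.3, Thm. I.7.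
* [MoeglinWaldspurger1995] C. Mœglin, J.-L. Waldspurger, *Spectral Decomposition and Eisenstein Series* (1995), I.2.17, II.1.5, II.2.1, II.2.4, VI.2.
* [CasselsFrohlichANT1967] J. W. S. Cassels, A. Fröhlich (eds.), *Algebraic Number Theory* (1967), Ch. II §16, Theorem (`C_K¹` compact).
* [TateThesis1967] J. Tate, *Fourier analysis in number fields and Hecke's zeta-functions*, in Cassels–Fröhlich (1967), §4.3.
-/

set_option autoImplicit false
set_option linter.dupNamespace false  -- the mandated namespace `…HodgeConjecture.HodgeConjecture.R90.S8` (LEAD #1 L1) repeats the summit's segment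

noncomputable section

open MeasureTheory Measure Set Filter Topology NumberField
open Literature.NumberTheory.Automorphic Literature.NumberTheory.Automorphic.UnitaryGroup Literature.NumberTheory.GaloisRepresentations AdelicGroupData
open Summit.HodgeConjecture.HodgeConjecture.Cruxes.H413.K2E1CharacterEisensteinU2Defs
open Summit.HodgeConjecture.HodgeConjecture.Cruxes.H413.K2E1ChiSectionSpaceU2Defs
open Summit.HodgeConjecture.HodgeConjecture.Cruxes.H413.K2E1ChiSectionBoundedOfUnitaryU2 (exists_bound_of_isChiSection_of_isUnitary)
open scoped ENNReal NNReal InnerProductSpace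

namespace Summit.HodgeConjecture.HodgeConjecture.R90.S8

variable (L : Type) [Field L] [NumberField L] [IsCMField L]
  (μ : Measure (quasiSplit (↥(maximalRealSubfield L)) L (IsCMField.complexConj L) 2).automorphicQuotient)
  {A Λ : Type*}

/-! ## §1 Abstract: what a block-model map factoring through `P_{Sc}` (and injective on `Sc`) gives for the R1 data -/

section Abstract

variable [AddCommGroup A] [Module ℂ A] [AddCommGroup Λ] [Module ℂ Λ]
  (U : (quasiSplit (↥(maximalRealSubfield L)) L (IsCMField.complexConj L) 2).L2 μ →ₗ[ℂ] A × Λ)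
  (K' : Subgroup (quasiSplit (↥(maximalRealSubfield L)) L (IsCMField.complexConj L) 2).Adelic) (ω : ↥K' →* ℂ) (χ : HeckeCharacter L)

/-- **(N-iface) FOR ALL `y`, FROM A FACTORISATION THROUGH THE BLOCK**: if `U y = U y′` for some `y′ ∈ Sc` with `y − y′ ⟂ Sc` (for the model maps of §2–§3: `y′ = P_{Sc} y`), then every `v ∈ Ln`
is orthogonal to every `y` with vanishing line coordinate `(U y).2 = 0` (★ read-back `inner_eq_zero_of_mem_resHLine`). [cite: ReedSimonI1980, Thm. II.3] [cite: MoeglinWaldspurger1995, VI.2] -/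
theorem inner_eq_zero_of_mem_resHLine_of_factor
    (hfac : ∀ y, ∃ y' ∈ resHBlock L μ K' ω χ, y - y' ∈ (resHBlock L μ K' ω χ)ᗮ ∧ U y = U y')
    {v : (quasiSplit (↥(maximalRealSubfield L)) L (IsCMField.complexConj L) 2).L2 μ} (hv : v ∈ resHLine L μ U K' ω χ)
    (y : (quasiSplit (↥(maximalRealSubfield L)) L (IsCMField.complexConj L) 2).L2 μ) (hy : (U y).2 = 0) : ⟪v, y⟫_ℂ = 0 := by
  obtain ⟨y', hy', hyy', hU⟩ := hfac y
  exact inner_eq_zero_of_mem_resHLine L μ U K' ω χ hv y ⟨y', hy', hyy', by rw [← hU]; exact hy⟩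

/-- **★ p862453's `hLnU` BYTES** (any guard set `S`, e.g. `V_P = eqLocus P id`; line coordinate `snd ∘ U`): from the factorisation. [cite: MoeglinWaldspurger1995, VI.2] -/
theorem hLnU_of_factor
    (hfac : ∀ y, ∃ y' ∈ resHBlock L μ K' ω χ, y - y' ∈ (resHBlock L μ K' ω χ)ᗮ ∧ U y = U y')
    (S : Set ((quasiSplit (↥(maximalRealSubfield L)) L (IsCMField.complexConj L) 2).L2 μ)) :
    ∀ v ∈ resHLine L μ U K' ω χ, ∀ y ∈ S, ((LinearMap.snd ℂ A Λ).comp U) y = 0 → ⟪v, y⟫_ℂ = 0 :=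
  fun _ hv y _ hy => inner_eq_zero_of_mem_resHLine_of_factor L μ U K' ω χ hfac hv y hy

/-- **`hOD` ABSTRACTLY**: if `U` is injective on `Sc` and has vanishing FIRST (atom) coordinate on `Sc` (an off-dual model), then the block has no pure atoms: `At = ⊥`. [cite: MoeglinWaldspurger1995, VI.2] -/
theorem resHAtom_eq_bot_of_injOn_of_fst_eq_zero
    (hinj : ∀ v ∈ resHBlock L μ K' ω χ, U v = 0 → v = 0) (hfst : ∀ v ∈ resHBlock L μ K' ω χ, (U v).1 = 0) :
    resHAtom L μ U K' ω χ = ⊥ := by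
  refine (Submodule.eq_bot_iff _).2 fun v hv => ?_
  obtain ⟨hvS, hv2⟩ := (mem_resHAtom_iff L μ U K' ω χ v).1 hv
  exact hinj v hvS (Prod.ext (hfst v hvS) hv2)

/-- A block without pure atoms is all line: `At = ⊥ ⟹ Ln = Sc`. [cite: MoeglinWaldspurger1995, VI.2] -/
theorem resHLine_eq_resHBlock_of_resHAtom_eq_bot (h : resHAtom L μ U K' ω χ = ⊥) : resHLine L μ U K' ω χ = resHBlock L μ K' ω χ := by
  apply le_antisymm (resHLine_le_resHBlock L μ U K' ω χ)
  intro v hv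
  refine (mem_resHLine_iff L μ U K' ω χ v).2 ⟨hv, ?_⟩
  rw [h, Submodule.bot_orthogonal_eq_top]
  trivial

/-- **`hLnP` REDUCED TO «`Sc ≤ V_P`»**: if the block projector (or any map) fixes the block, it fixes `Ln ≤ Sc`. [cite: MoeglinWaldspurger1995, I.2.18] -/
theorem hLnP_of_resHBlock_le {V : Type*} (P : (quasiSplit (↥(maximalRealSubfield L)) L (IsCMField.complexConj L) 2).L2 μ → V) (Q : (quasiSplit (↥(maximalRealSubfield L)) L (IsCMField.complexConj L) 2).L2 μ → V)
    (hSc : ∀ v ∈ resHBlock L μ K' ω χ, P v = Q v) : ∀ v ∈ resHLine L μ U K' ω χ, P v = Q v :=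
  fun v hv => hSc v (resHLine_le_resHBlock L μ U K' ω χ hv)

end Abstract

/-! ## §2 The self-dual-type model map `U = ι ∘ U_iso ∘ P_{Sc}` from an isometry `U_iso : Sc →ₗᵢ (A × Λ)_{ℓ²}` -/

section SelfDualType

variable [NormedAddCommGroup A] [InnerProductSpace ℂ A] [NormedAddCommGroup Λ] [InnerProductSpace ℂ Λ]
  (K' : Subgroup (quasiSplit (↥(maximalRealSubfield L)) L (IsCMField.complexConj L) 2).Adelic) (ω : ↥K' →* ℂ) (χ : HeckeCharacter L)

/-- Instance supply (used with `haveI` in statements): the block is complete (closed in the Hilbert space `L²`), so `P_{Sc}` exists. [cite: ReedSimonI1980, Thm. II.3] -/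
theorem completeSpace_resHBlock : CompleteSpace ↥(resHBlock L μ K' ω χ) :=
  (isClosed_resHBlock L μ K' ω χ).completeSpace_coe

/-- On the block the model map is `ι ∘ U_iso`: `U v = ofLp (U_iso v)` for `v ∈ Sc`. [cite: ReedSimonI1980, Thm. II.3] -/
theorem sdModelMap_apply_of_mem (Uiso : haveI := completeSpace_resHBlock L μ K' ω χ; ↥(resHBlock L μ K' ω χ) →ₗᵢ[ℂ] WithLp 2 (A × Λ))
    {v : (quasiSplit (↥(maximalRealSubfield L)) L (IsCMField.complexConj L) 2).L2 μ} (hv : v ∈ resHBlock L μ K' ω χ) :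
    haveI := completeSpace_resHBlock L μ K' ω χ
    ((WithLp.linearEquiv 2 ℂ (A × Λ)).toLinearMap ∘ₗ (Uiso.toContinuousLinearMap.comp (resHBlock L μ K' ω χ).orthogonalProjectionOnto).toLinearMap) v = WithLp.ofLp (Uiso ⟨v, hv⟩) := by
  haveI := completeSpace_resHBlock L μ K' ω χ
  change WithLp.ofLp (Uiso ((resHBlock L μ K' ω χ).orthogonalProjectionOnto v)) = WithLp.ofLp (Uiso ⟨v, hv⟩)
  rw [show (resHBlock L μ K' ω χ).orthogonalProjectionOnto v = ⟨v, hv⟩ from Submodule.orthogonalProjectionOnto_mem_subspace_eq_self (⟨v, hv⟩ : ↥(resHBlock L μ K' ω χ))]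

/-- FACTORISATION through the block: `U y = U (P_{Sc} y)` with `P_{Sc} y ∈ Sc`, `y − P_{Sc} y ⟂ Sc`. [cite: ReedSimonI1980, Thm. II.3] -/
theorem sdModelMap_factor (Uiso : haveI := completeSpace_resHBlock L μ K' ω χ; ↥(resHBlock L μ K' ω χ) →ₗᵢ[ℂ] WithLp 2 (A × Λ)) :
    haveI := completeSpace_resHBlock L μ K' ω χ
    ∀ y, ∃ y' ∈ resHBlock L μ K' ω χ, y - y' ∈ (resHBlock L μ K' ω χ)ᗮ ∧
      ((WithLp.linearEquiv 2 ℂ (A × Λ)).toLinearMap ∘ₗ (Uiso.toContinuousLinearMap.comp (resHBlock L μ K' ω χ).orthogonalProjectionOnto).toLinearMap) y =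
        ((WithLp.linearEquiv 2 ℂ (A × Λ)).toLinearMap ∘ₗ (Uiso.toContinuousLinearMap.comp (resHBlock L μ K' ω χ).orthogonalProjectionOnto).toLinearMap) y' := by
  haveI := completeSpace_resHBlock L μ K' ω χ
  intro y
  refine ⟨(resHBlock L μ K' ω χ).starProjection y, Submodule.starProjection_apply_mem _ y, Submodule.sub_starProjection_mem_orthogonal y, ?_⟩
  change WithLp.ofLp (Uiso ((resHBlock L μ K' ω χ).orthogonalProjectionOnto y)) = WithLp.ofLp (Uiso ((resHBlock L μ K' ω χ).orthogonalProjectionOnto ((resHBlock L μ K' ω χ).starProjection y)))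
  rw [Submodule.orthogonalProjectionOnto_starProjection_of_le le_rfl]

/-- INJECTIVITY on the block: `v ∈ Sc`, `U v = 0 ⟹ v = 0` (isometries are injective). [cite: ReedSimonI1980, Thm. I.7] -/
theorem sdModelMap_injOn (Uiso : haveI := completeSpace_resHBlock L μ K' ω χ; ↥(resHBlock L μ K' ω χ) →ₗᵢ[ℂ] WithLp 2 (A × Λ)) :
    haveI := completeSpace_resHBlock L μ K' ω χ
    ∀ v ∈ resHBlock L μ K' ω χ, ((WithLp.linearEquiv 2 ℂ (A × Λ)).toLinearMap ∘ₗ (Uiso.toContinuousLinearMap.comp (resHBlock L μ K' ω χ).orthogonalProjectionOnto).toLinearMap) v = 0 → v = 0 := by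
  haveI := completeSpace_resHBlock L μ K' ω χ
  intro v hv h0
  rw [sdModelMap_apply_of_mem L μ K' ω χ Uiso hv] at h0
  have h1 : Uiso ⟨v, hv⟩ = 0 := by
    have := congrArg (WithLp.toLp 2) h0
    simpa using this
  have h2 : (⟨v, hv⟩ : ↥(resHBlock L μ K' ω χ)) = 0 := by
    have hn : ‖(⟨v, hv⟩ : ↥(resHBlock L μ K' ω χ))‖ = 0 := by rw [← Uiso.norm_map, h1, norm_zero]
    exact norm_eq_zero.1 hn
  exact congrArg Subtype.val h2

/-- **(N-iface) FOR THE SELF-DUAL-TYPE MODEL, ALL `y`**: `v ∈ Ln`, `(U y).2 = 0 ⟹ ⟪v, y⟫ = 0`. [cite: MoeglinWaldspurger1995, VI.2] [cite: ReedSimonI1980, Thm. II.3] -/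
theorem inner_eq_zero_of_mem_resHLine_sdModelMap (Uiso : haveI := completeSpace_resHBlock L μ K' ω χ; ↥(resHBlock L μ K' ω χ) →ₗᵢ[ℂ] WithLp 2 (A × Λ)) :
    haveI := completeSpace_resHBlock L μ K' ω χ
    ∀ v ∈ resHLine L μ ((WithLp.linearEquiv 2 ℂ (A × Λ)).toLinearMap ∘ₗ (Uiso.toContinuousLinearMap.comp (resHBlock L μ K' ω χ).orthogonalProjectionOnto).toLinearMap) K' ω χ,
      ∀ y, (((WithLp.linearEquiv 2 ℂ (A × Λ)).toLinearMap ∘ₗ (Uiso.toContinuousLinearMap.comp (resHBlock L μ K' ω χ).orthogonalProjectionOnto).toLinearMap) y).2 = 0 → ⟪v, y⟫_ℂ = 0 := by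
  haveI := completeSpace_resHBlock L μ K' ω χ
  intro v hv y hy
  exact inner_eq_zero_of_mem_resHLine_of_factor L μ _ K' ω χ (sdModelMap_factor L μ K' ω χ Uiso) hv y hy

/-- **★ p862453's `hLnU` FOR THE SELF-DUAL-TYPE MODEL** (any guard set `S`; line coordinate `snd ∘ U`). [cite: MoeglinWaldspurger1995, VI.2] -/
theorem hLnU_sdModelMap (Uiso : haveI := completeSpace_resHBlock L μ K' ω χ; ↥(resHBlock L μ K' ω χ) →ₗᵢ[ℂ] WithLp 2 (A × Λ))
    (S : Set ((quasiSplit (↥(maximalRealSubfield L)) L (IsCMField.complexConj L) 2).L2 μ)) :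
    haveI := completeSpace_resHBlock L μ K' ω χ
    ∀ v ∈ resHLine L μ ((WithLp.linearEquiv 2 ℂ (A × Λ)).toLinearMap ∘ₗ (Uiso.toContinuousLinearMap.comp (resHBlock L μ K' ω χ).orthogonalProjectionOnto).toLinearMap) K' ω χ,
      ∀ y ∈ S, ((LinearMap.snd ℂ A Λ).comp ((WithLp.linearEquiv 2 ℂ (A × Λ)).toLinearMap ∘ₗ (Uiso.toContinuousLinearMap.comp (resHBlock L μ K' ω χ).orthogonalProjectionOnto).toLinearMap)) y = 0 →
        ⟪v, y⟫_ℂ = 0 := by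
  haveI := completeSpace_resHBlock L μ K' ω χ
  exact hLnU_of_factor L μ _ K' ω χ (sdModelMap_factor L μ K' ω χ Uiso) S

end SelfDualType

/-! ## §3 The off-dual model map `U = (0, U_iso ∘ P_{Sc})` from an isometry `U_iso : Sc →ₗᵢ Λ` — no pure atoms -/

section OffDualType

variable [AddCommGroup A] [Module ℂ A] [NormedAddCommGroup Λ] [InnerProductSpace ℂ Λ]
  (K' : Subgroup (quasiSplit (↥(maximalRealSubfield L)) L (IsCMField.complexConj L) 2).Adelic) (ω : ↥K' →* ℂ) (χ : HeckeCharacter L)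

/-- FACTORISATION through the block for the off-dual model. [cite: ReedSimonI1980, Thm. II.3] -/
theorem odModelMap_factor (Uiso : haveI := completeSpace_resHBlock L μ K' ω χ; ↥(resHBlock L μ K' ω χ) →ₗᵢ[ℂ] Λ) :
    haveI := completeSpace_resHBlock L μ K' ω χ
    ∀ y, ∃ y' ∈ resHBlock L μ K' ω χ, y - y' ∈ (resHBlock L μ K' ω χ)ᗮ ∧
      ((0 : (quasiSplit (↥(maximalRealSubfield L)) L (IsCMField.complexConj L) 2).L2 μ →ₗ[ℂ] A).prod (Uiso.toContinuousLinearMap.comp (resHBlock L μ K' ω χ).orthogonalProjectionOnto).toLinearMap) y =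
        ((0 : (quasiSplit (↥(maximalRealSubfield L)) L (IsCMField.complexConj L) 2).L2 μ →ₗ[ℂ] A).prod (Uiso.toContinuousLinearMap.comp (resHBlock L μ K' ω χ).orthogonalProjectionOnto).toLinearMap) y' := by
  haveI := completeSpace_resHBlock L μ K' ω χ
  intro y
  refine ⟨(resHBlock L μ K' ω χ).starProjection y, Submodule.starProjection_apply_mem _ y, Submodule.sub_starProjection_mem_orthogonal y, ?_⟩
  change ((0 : A), Uiso ((resHBlock L μ K' ω χ).orthogonalProjectionOnto y)) = ((0 : A), Uiso ((resHBlock L μ K' ω χ).orthogonalProjectionOnto ((resHBlock L μ K' ω χ).starProjection y)))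
  rw [Submodule.orthogonalProjectionOnto_starProjection_of_le le_rfl]

/-- The off-dual model has vanishing atom coordinate everywhere. [cite: MoeglinWaldspurger1995, VI.2] -/
theorem odModelMap_fst (Uiso : haveI := completeSpace_resHBlock L μ K' ω χ; ↥(resHBlock L μ K' ω χ) →ₗᵢ[ℂ] Λ)
    (v : (quasiSplit (↥(maximalRealSubfield L)) L (IsCMField.complexConj L) 2).L2 μ) :
    haveI := completeSpace_resHBlock L μ K' ω χ
    (((0 : (quasiSplit (↥(maximalRealSubfield L)) L (IsCMField.complexConj L) 2).L2 μ →ₗ[ℂ] A).prod (Uiso.toContinuousLinearMap.comp (resHBlock L μ K' ω χ).orthogonalProjectionOnto).toLinearMap) v).1 = 0 :=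
  rfl

/-- INJECTIVITY on the block for the off-dual model. [cite: ReedSimonI1980, Thm. I.7] -/
theorem odModelMap_injOn (Uiso : haveI := completeSpace_resHBlock L μ K' ω χ; ↥(resHBlock L μ K' ω χ) →ₗᵢ[ℂ] Λ) :
    haveI := completeSpace_resHBlock L μ K' ω χ
    ∀ v ∈ resHBlock L μ K' ω χ, ((0 : (quasiSplit (↥(maximalRealSubfield L)) L (IsCMField.complexConj L) 2).L2 μ →ₗ[ℂ] A).prod (Uiso.toContinuousLinearMap.comp (resHBlock L μ K' ω χ).orthogonalProjectionOnto).toLinearMap) v = 0 → v = 0 := by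
  haveI := completeSpace_resHBlock L μ K' ω χ
  intro v hv h0
  have h1 : Uiso ((resHBlock L μ K' ω χ).orthogonalProjectionOnto v) = 0 := (Prod.mk_eq_zero.1 h0).2
  rw [show (resHBlock L μ K' ω χ).orthogonalProjectionOnto v = ⟨v, hv⟩ from Submodule.orthogonalProjectionOnto_mem_subspace_eq_self (⟨v, hv⟩ : ↥(resHBlock L μ K' ω χ))] at h1
  have h2 : (⟨v, hv⟩ : ↥(resHBlock L μ K' ω χ)) = 0 := by
    have hn : ‖(⟨v, hv⟩ : ↥(resHBlock L μ K' ω χ))‖ = 0 := by rw [← Uiso.norm_map, h1, norm_zero]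
    exact norm_eq_zero.1 hn
  exact congrArg Subtype.val h2

/-- **`hOD` FOR THE OFF-DUAL MODEL — NO PURE ATOMS: `At = ⊥`.** [cite: MoeglinWaldspurger1995, VI.2] -/
theorem resHAtom_odModelMap_eq_bot (Uiso : haveI := completeSpace_resHBlock L μ K' ω χ; ↥(resHBlock L μ K' ω χ) →ₗᵢ[ℂ] Λ) :
    haveI := completeSpace_resHBlock L μ K' ω χ
    resHAtom L μ (((0 : (quasiSplit (↥(maximalRealSubfield L)) L (IsCMField.complexConj L) 2).L2 μ →ₗ[ℂ] A).prod (Uiso.toContinuousLinearMap.comp (resHBlock L μ K' ω χ).orthogonalProjectionOnto).toLinearMap)) K' ω χ = ⊥ := by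
  haveI := completeSpace_resHBlock L μ K' ω χ
  exact resHAtom_eq_bot_of_injOn_of_fst_eq_zero L μ _ K' ω χ (odModelMap_injOn L μ K' ω χ Uiso) fun v _ => odModelMap_fst L μ K' ω χ Uiso v

/-- The off-dual block is all line: `Ln = Sc`. [cite: MoeglinWaldspurger1995, VI.2] -/
theorem resHLine_odModelMap_eq_resHBlock (Uiso : haveI := completeSpace_resHBlock L μ K' ω χ; ↥(resHBlock L μ K' ω χ) →ₗᵢ[ℂ] Λ) :
    haveI := completeSpace_resHBlock L μ K' ω χ
    resHLine L μ (((0 : (quasiSplit (↥(maximalRealSubfield L)) L (IsCMField.complexConj L) 2).L2 μ →ₗ[ℂ] A).prod (Uiso.toContinuousLinearMap.comp (resHBlock L μ K' ω χ).orthogonalProjectionOnto).toLinearMap)) K' ω χ =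
      resHBlock L μ K' ω χ := by
  haveI := completeSpace_resHBlock L μ K' ω χ
  exact resHLine_eq_resHBlock_of_resHAtom_eq_bot L μ _ K' ω χ (resHAtom_odModelMap_eq_bot L μ K' ω χ Uiso)

/-- **★ p862453's `hLnU` FOR THE OFF-DUAL MODEL** (any guard set `S`; line coordinate `snd ∘ U = U_iso ∘ P_{Sc}`). [cite: MoeglinWaldspurger1995, VI.2] -/
theorem hLnU_odModelMap (Uiso : haveI := completeSpace_resHBlock L μ K' ω χ; ↥(resHBlock L μ K' ω χ) →ₗᵢ[ℂ] Λ)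
    (S : Set ((quasiSplit (↥(maximalRealSubfield L)) L (IsCMField.complexConj L) 2).L2 μ)) :
    haveI := completeSpace_resHBlock L μ K' ω χ
    ∀ v ∈ resHLine L μ (((0 : (quasiSplit (↥(maximalRealSubfield L)) L (IsCMField.complexConj L) 2).L2 μ →ₗ[ℂ] A).prod (Uiso.toContinuousLinearMap.comp (resHBlock L μ K' ω χ).orthogonalProjectionOnto).toLinearMap)) K' ω χ,
      ∀ y ∈ S, ((LinearMap.snd ℂ A Λ).comp (((0 : (quasiSplit (↥(maximalRealSubfield L)) L (IsCMField.complexConj L) 2).L2 μ →ₗ[ℂ] A).prod (Uiso.toContinuousLinearMap.comp (resHBlock L μ K' ω χ).orthogonalProjectionOnto).toLinearMap))) y = 0 →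
        ⟪v, y⟫_ℂ = 0 := by
  haveI := completeSpace_resHBlock L μ K' ω χ
  exact hLnU_of_factor L μ _ K' ω χ (odModelMap_factor L μ K' ω χ Uiso) S

end OffDualType

/-! ## §4 The bounded-section letter `hχb` from unitarity, by name -/

/-- **`hχb` PAID BY NAME**: for a UNITARY Hecke character `χ`, every continuous `φ ∈ V(χ, K′, ω)` is bounded (★ `exists_bound_of_isChiSection_of_isUnitary`: Iwasawa `g = b·k`,
`|φ(bk)| = |φ(k)| ≤ max_K |φ|`) — the shape of the letter `hχb` of ★ R6 ∕ (O) ★ p862491 ∕ HEAD″ at any `(K′, ω)`. [cite: MoeglinWaldspurger1995, I.2.17, II.1.5] -/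
theorem hχb_of_isUnitary (K' : Subgroup (quasiSplit (↥(maximalRealSubfield L)) L (IsCMField.complexConj L) 2).Adelic) (ω : ↥K' →* ℂ) {χ : HeckeCharacter L} (hχ : χ.IsUnitary) :
    ∀ φ : (quasiSplit (↥(maximalRealSubfield L)) L (IsCMField.complexConj L) 2).Adelic → ℂ, φ ∈ chiSectionSpace χ K' (ω : ↥K' → ℂ) → Continuous φ → ∃ M : ℝ, ∀ g, ‖φ g‖ ≤ M :=
  fun _ hφ hφc => exists_bound_of_isChiSection_of_isUnitary L 2 hχ hφ.1 hφc

/-- **`hu` FOR A C7 INDEX, BY NAME**: a ray-trivial Hecke character is unitary (★ `HeckeCharacter.isUnitary_of_map_posRealIdele`: `|χ|` is a bounded character of the compact `C_L¹`).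
[cite: CasselsFrohlichANT1967, Ch. II §16 Theorem] -/
theorem isUnitary_coe_index (K' : Subgroup (quasiSplit (↥(maximalRealSubfield L)) L (IsCMField.complexConj L) 2).Adelic) (ω : ↥K' →* ℂ)
    (b : ↥{χ : HeckeCharacter L | (∀ r : ℝ≥0ˣ, χ (posRealIdele L r) = 1) ∧ chiSectionSpace χ K' (ω : ↥K' → ℂ) ≠ ⊥}) : (b : HeckeCharacter L).IsUnitary :=
  HeckeCharacter.isUnitary_of_map_posRealIdele b.2.1

/-- **`hχb` FOR A C7 INDEX, OUTRIGHT** (§4 ∘ `isUnitary_coe_index`). [cite: MoeglinWaldspurger1995, I.2.17, II.1.5] -/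
theorem hχb_index (K' : Subgroup (quasiSplit (↥(maximalRealSubfield L)) L (IsCMField.complexConj L) 2).Adelic) (ω : ↥K' →* ℂ)
    (b : ↥{χ : HeckeCharacter L | (∀ r : ℝ≥0ˣ, χ (posRealIdele L r) = 1) ∧ chiSectionSpace χ K' (ω : ↥K' → ℂ) ≠ ⊥}) :
    ∀ φ : (quasiSplit (↥(maximalRealSubfield L)) L (IsCMField.complexConj L) 2).Adelic → ℂ, φ ∈ chiSectionSpace (b : HeckeCharacter L) K' (ω : ↥K' → ℂ) → Continuous φ → ∃ M : ℝ, ∀ g, ‖φ g‖ ≤ M :=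
  hχb_of_isUnitary L K' ω (isUnitary_coe_index L K' ω b)

/-! ## §5 Letter (O) with `hu`, `hχb` discharged: visible = structural Haar data + the model letter `hOD` -/

section LetterO

variable [MeasurableSpace (quasiSplit (↥(maximalRealSubfield L)) L (IsCMField.complexConj L) 2).Adelic] [BorelSpace (quasiSplit (↥(maximalRealSubfield L)) L (IsCMField.complexConj L) 2).Adelic]
  [MeasurableSpace (AdeleRing (𝓞 L) L)ˣ] [BorelSpace (AdeleRing (𝓞 L) L)ˣ]

/-- **LETTER (O) OF ★ p862113 WITH `hu` AND `hχb` DISCHARGED**: at any level datum `(K′, ω)` and for any block-model family `U b`, `(⨆_b At_b) ⟂ (⨆_b Ln_b)` modulo ONLY ★ R6's structural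
Haar ∕ fundamental-domain data `νG μK νI 𝓕I ν 𝓕`, the print's `hc`, and the model letter `hOD` «an off-dual block has no pure atoms» (discharged by §6 for right-modelled blocks).
[cite: MoeglinWaldspurger1995, II.2.1, VI.2] [cite: TateThesis1967, §4.3] -/
theorem isOrtho_iSup_resHAtom_iSup_resHLine_of_hOD
    [(quasiSplit (↥(maximalRealSubfield L)) L (IsCMField.complexConj L) 2).IsAutomorphicMeasure μ]
    (νG : Measure (quasiSplit (↥(maximalRealSubfield L)) L (IsCMField.complexConj L) 2).Adelic) [νG.IsHaarMeasure] [νG.IsInvInvariant]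
    (μK : Measure ((standardMaximalCompactGL 2 L).comap (adelicVal (↥(maximalRealSubfield L)) L (IsCMField.complexConj L) 2 ((StdForm.antidiagonal 2).over L)) : Subgroup (quasiSplit (↥(maximalRealSubfield L)) L (IsCMField.complexConj L) 2).Adelic)) [μK.IsHaarMeasure]
    (νI : Measure (AdeleRing (𝓞 L) L)ˣ) [νI.IsHaarMeasure]
    {𝓕I : Set (AdeleRing (𝓞 L) L)ˣ} (h𝓕I : IsIdeleClassDomain L 𝓕I)
    (ν : Measure ↥(adelicUnipotent (↥(maximalRealSubfield L)) L (IsCMField.complexConj L) 2)) [ν.IsHaarMeasure] {𝓕 : Set ↥(adelicUnipotent (↥(maximalRealSubfield L)) L (IsCMField.complexConj L) 2)}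
    (h𝓕N : IsFundamentalDomain ↥(rationalUnipotent (↥(maximalRealSubfield L)) L (IsCMField.complexConj L) 2) 𝓕 ν) (h𝓕c : IsCompact (closure 𝓕)) (h𝓕₀ : ν 𝓕 ≠ 0)
    (hc : IsCMField.complexConj L * IsCMField.complexConj L = 1)
    (K' : Subgroup (quasiSplit (↥(maximalRealSubfield L)) L (IsCMField.complexConj L) 2).Adelic) (ω : ↥K' →* ℂ)
    {A' Λ' : ↥{χ : HeckeCharacter L | (∀ r : ℝ≥0ˣ, χ (posRealIdele L r) = 1) ∧ chiSectionSpace χ K' (ω : ↥K' → ℂ) ≠ ⊥} → Type*}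
    [∀ b, AddCommGroup (A' b)] [∀ b, Module ℂ (A' b)] [∀ b, AddCommGroup (Λ' b)] [∀ b, Module ℂ (Λ' b)]
    (U : ∀ b : ↥{χ : HeckeCharacter L | (∀ r : ℝ≥0ˣ, χ (posRealIdele L r) = 1) ∧ chiSectionSpace χ K' (ω : ↥K' → ℂ) ≠ ⊥},
      (quasiSplit (↥(maximalRealSubfield L)) L (IsCMField.complexConj L) 2).L2 μ →ₗ[ℂ] A' b × Λ' b)
    (hOD : ∀ b : ↥{χ : HeckeCharacter L | (∀ r : ℝ≥0ˣ, χ (posRealIdele L r) = 1) ∧ chiSectionSpace χ K' (ω : ↥K' → ℂ) ≠ ⊥},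
      reflectChar (IsCMField.complexConj L) (b : HeckeCharacter L) ≠ (b : HeckeCharacter L) → resHAtom L μ (U b) K' ω (b : HeckeCharacter L) = ⊥) :
    (⨆ b, resHAtom L μ (U b) K' ω (b : HeckeCharacter L)) ⟂ (⨆ b, resHLine L μ (U b) K' ω (b : HeckeCharacter L)) :=
  isOrtho_iSup_resHAtom_iSup_resHLine_of_letters' L μ νG μK νI h𝓕I ν h𝓕N h𝓕c h𝓕₀ hc K' ω U (fun b => isUnitary_coe_index L K' ω b) (fun b => hχb_index L K' ω b) hOD

end LetterO

/-! ## §6 The family packaging over the C7 index: `U b` from per-block (self-dual ⊕ off-dual) model data -/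

section Family

variable (K' : Subgroup (quasiSplit (↥(maximalRealSubfield L)) L (IsCMField.complexConj L) 2).Adelic) (ω : ↥K' →* ℂ)
  {A' Λ' : ↥{χ : HeckeCharacter L | (∀ r : ℝ≥0ˣ, χ (posRealIdele L r) = 1) ∧ chiSectionSpace χ K' (ω : ↥K' → ℂ) ≠ ⊥} → Type*}
  [∀ b, NormedAddCommGroup (A' b)] [∀ b, InnerProductSpace ℂ (A' b)] [∀ b, NormedAddCommGroup (Λ' b)] [∀ b, InnerProductSpace ℂ (Λ' b)]

/-- **THE BLOCK-MODEL FAMILY.**  Given, for every block `b` of the C7 index `S_ω(K′)`, EITHER a self-dual-type Plancherel isometry `Sc_b →ₗᵢ (A b × Λ b)_{ℓ²}` (`Sum.inl`) OR an off-dual one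
`Sc_b →ₗᵢ Λ b` (`Sum.inr`), there is a family `U b : L² →ₗ[ℂ] A b × Λ b` (namely §2's `ι ∘ U_iso ∘ P_{Sc}` resp. §3's `(0, U_iso ∘ P_{Sc})`) such that, for every `b`: (`hUfac`) `U b`
factors through `P_{Sc_b}`; (`hUinj`) `U b` is injective on `Sc_b`; (read-backs) `U b v = ofLp (U_iso v)` resp. `U b v = (0, U_iso v)` for `v ∈ Sc_b`; and (`hUbot`) every
RIGHT-modelled block has `resHAtom (U b) = ⊥`.  With §1: `hLnU` for every `b` (`hLnU_of_factor … (hUfac b)`), and `hOD` as soon as the off-dual blocks are right-modelled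
(`hOD_of_blockModelFamily`). [cite: ReedSimonI1980, Thm. II.3, Thm. I.7] [cite: MoeglinWaldspurger1995, II.2.4, VI.2] -/
theorem exists_blockModelFamily
    (model : ∀ b : ↥{χ : HeckeCharacter L | (∀ r : ℝ≥0ˣ, χ (posRealIdele L r) = 1) ∧ chiSectionSpace χ K' (ω : ↥K' → ℂ) ≠ ⊥},
      (↥(resHBlock L μ K' ω (b : HeckeCharacter L)) →ₗᵢ[ℂ] WithLp 2 (A' b × Λ' b)) ⊕ (↥(resHBlock L μ K' ω (b : HeckeCharacter L)) →ₗᵢ[ℂ] Λ' b)) :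
    ∃ U : ∀ b : ↥{χ : HeckeCharacter L | (∀ r : ℝ≥0ˣ, χ (posRealIdele L r) = 1) ∧ chiSectionSpace χ K' (ω : ↥K' → ℂ) ≠ ⊥},
        (quasiSplit (↥(maximalRealSubfield L)) L (IsCMField.complexConj L) 2).L2 μ →ₗ[ℂ] A' b × Λ' b,
      (∀ (b : ↥{χ : HeckeCharacter L | (∀ r : ℝ≥0ˣ, χ (posRealIdele L r) = 1) ∧ chiSectionSpace χ K' (ω : ↥K' → ℂ) ≠ ⊥}) (y : (quasiSplit (↥(maximalRealSubfield L)) L (IsCMField.complexConj L) 2).L2 μ),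
        ∃ y' ∈ resHBlock L μ K' ω (b : HeckeCharacter L), y - y' ∈ (resHBlock L μ K' ω (b : HeckeCharacter L))ᗮ ∧ U b y = U b y') ∧
      (∀ (b : ↥{χ : HeckeCharacter L | (∀ r : ℝ≥0ˣ, χ (posRealIdele L r) = 1) ∧ chiSectionSpace χ K' (ω : ↥K' → ℂ) ≠ ⊥}), ∀ v ∈ resHBlock L μ K' ω (b : HeckeCharacter L), U b v = 0 → v = 0) ∧
      (∀ (b : ↥{χ : HeckeCharacter L | (∀ r : ℝ≥0ˣ, χ (posRealIdele L r) = 1) ∧ chiSectionSpace χ K' (ω : ↥K' → ℂ) ≠ ⊥}) (Uiso : ↥(resHBlock L μ K' ω (b : HeckeCharacter L)) →ₗᵢ[ℂ] WithLp 2 (A' b × Λ' b)), model b = Sum.inl Uiso →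
        ∀ (v : (quasiSplit (↥(maximalRealSubfield L)) L (IsCMField.complexConj L) 2).L2 μ) (hv : v ∈ resHBlock L μ K' ω (b : HeckeCharacter L)), U b v = WithLp.ofLp (Uiso ⟨v, hv⟩)) ∧
      (∀ (b : ↥{χ : HeckeCharacter L | (∀ r : ℝ≥0ˣ, χ (posRealIdele L r) = 1) ∧ chiSectionSpace χ K' (ω : ↥K' → ℂ) ≠ ⊥}) (Uiso : ↥(resHBlock L μ K' ω (b : HeckeCharacter L)) →ₗᵢ[ℂ] Λ' b), model b = Sum.inr Uiso →
        ∀ (v : (quasiSplit (↥(maximalRealSubfield L)) L (IsCMField.complexConj L) 2).L2 μ) (hv : v ∈ resHBlock L μ K' ω (b : HeckeCharacter L)), U b v = ((0 : A' b), Uiso ⟨v, hv⟩)) ∧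
      (∀ (b : ↥{χ : HeckeCharacter L | (∀ r : ℝ≥0ˣ, χ (posRealIdele L r) = 1) ∧ chiSectionSpace χ K' (ω : ↥K' → ℂ) ≠ ⊥}), (∃ Uiso, model b = Sum.inr Uiso) → resHAtom L μ (U b) K' ω (b : HeckeCharacter L) = ⊥) := by
  classical
  refine ⟨fun b => Sum.elim
      (fun Uiso : ↥(resHBlock L μ K' ω (b : HeckeCharacter L)) →ₗᵢ[ℂ] WithLp 2 (A' b × Λ' b) =>
        haveI := completeSpace_resHBlock L μ K' ω (b : HeckeCharacter L)
        (WithLp.linearEquiv 2 ℂ (A' b × Λ' b)).toLinearMap ∘ₗ (Uiso.toContinuousLinearMap.comp (resHBlock L μ K' ω (b : HeckeCharacter L)).orthogonalProjectionOnto).toLinearMap)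
      (fun Uiso : ↥(resHBlock L μ K' ω (b : HeckeCharacter L)) →ₗᵢ[ℂ] Λ' b =>
        haveI := completeSpace_resHBlock L μ K' ω (b : HeckeCharacter L)
        ((0 : (quasiSplit (↥(maximalRealSubfield L)) L (IsCMField.complexConj L) 2).L2 μ →ₗ[ℂ] A' b).prod (Uiso.toContinuousLinearMap.comp (resHBlock L μ K' ω (b : HeckeCharacter L)).orthogonalProjectionOnto).toLinearMap))
      (model b), fun b => ?_, fun b => ?_, fun b Uiso hb => ?_, fun b Uiso hb => ?_, fun b hb => ?_⟩
  · -- factorisation, by cases on the model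
    rcases hm : model b with Uiso | Uiso
    · simpa only [hm, Sum.elim_inl] using sdModelMap_factor L μ K' ω (b : HeckeCharacter L) Uiso
    · simpa only [hm, Sum.elim_inr] using odModelMap_factor L μ K' ω (b : HeckeCharacter L) Uiso
  · rcases hm : model b with Uiso | Uiso
    · simpa only [hm, Sum.elim_inl] using sdModelMap_injOn L μ K' ω (b : HeckeCharacter L) Uiso
    · simpa only [hm, Sum.elim_inr] using odModelMap_injOn L μ K' ω (b : HeckeCharacter L) Uiso
  · intro v hv
    simp only [hb, Sum.elim_inl]
    exact sdModelMap_apply_of_mem L μ K' ω (b : HeckeCharacter L) Uiso hv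
  · intro v hv
    haveI := completeSpace_resHBlock L μ K' ω (b : HeckeCharacter L)
    simp only [hb, Sum.elim_inr]
    change ((0 : A' b), Uiso ((resHBlock L μ K' ω (b : HeckeCharacter L)).orthogonalProjectionOnto v)) = ((0 : A' b), Uiso ⟨v, hv⟩)
    rw [show (resHBlock L μ K' ω (b : HeckeCharacter L)).orthogonalProjectionOnto v = ⟨v, hv⟩ from
      Submodule.orthogonalProjectionOnto_mem_subspace_eq_self (⟨v, hv⟩ : ↥(resHBlock L μ K' ω (b : HeckeCharacter L)))]
  · obtain ⟨Uiso, hm⟩ := hb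
    simp only [hm, Sum.elim_inr]
    exact resHAtom_odModelMap_eq_bot L μ K' ω (b : HeckeCharacter L) Uiso

/-- **`hOD` FROM THE FAMILY**: if every OFF-DUAL block (`χ_bʷ ≠ χ_b`) is right-modelled, the model letter `hOD` of (O) holds for the family's `U`. [cite: MoeglinWaldspurger1995, VI.2] -/
theorem hOD_of_blockModelFamily
    {U : ∀ b : ↥{χ : HeckeCharacter L | (∀ r : ℝ≥0ˣ, χ (posRealIdele L r) = 1) ∧ chiSectionSpace χ K' (ω : ↥K' → ℂ) ≠ ⊥},
      (quasiSplit (↥(maximalRealSubfield L)) L (IsCMField.complexConj L) 2).L2 μ →ₗ[ℂ] A' b × Λ' b}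
    {model : ∀ b : ↥{χ : HeckeCharacter L | (∀ r : ℝ≥0ˣ, χ (posRealIdele L r) = 1) ∧ chiSectionSpace χ K' (ω : ↥K' → ℂ) ≠ ⊥},
      (↥(resHBlock L μ K' ω (b : HeckeCharacter L)) →ₗᵢ[ℂ] WithLp 2 (A' b × Λ' b)) ⊕ (↥(resHBlock L μ K' ω (b : HeckeCharacter L)) →ₗᵢ[ℂ] Λ' b)}
    (hUbot : ∀ (b : ↥{χ : HeckeCharacter L | (∀ r : ℝ≥0ˣ, χ (posRealIdele L r) = 1) ∧ chiSectionSpace χ K' (ω : ↥K' → ℂ) ≠ ⊥}), (∃ Uiso, model b = Sum.inr Uiso) → resHAtom L μ (U b) K' ω (b : HeckeCharacter L) = ⊥)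
    (hright : ∀ b : ↥{χ : HeckeCharacter L | (∀ r : ℝ≥0ˣ, χ (posRealIdele L r) = 1) ∧ chiSectionSpace χ K' (ω : ↥K' → ℂ) ≠ ⊥},
      reflectChar (IsCMField.complexConj L) (b : HeckeCharacter L) ≠ (b : HeckeCharacter L) → ∃ Uiso, model b = Sum.inr Uiso) :
    ∀ b : ↥{χ : HeckeCharacter L | (∀ r : ℝ≥0ˣ, χ (posRealIdele L r) = 1) ∧ chiSectionSpace χ K' (ω : ↥K' → ℂ) ≠ ⊥},
      reflectChar (IsCMField.complexConj L) (b : HeckeCharacter L) ≠ (b : HeckeCharacter L) → resHAtom L μ (U b) K' ω (b : HeckeCharacter L) = ⊥ :=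
  fun b hb => hUbot b (hright b hb)

end Family

end Summit.HodgeConjecture.HodgeConjecture.R90.S8

end
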